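import Mathlib.GroupTheory.Perm.Cycle.Type
import Mathlib.Data.Int.Order.Units
import Literature.Combinatorics.SimpleGraph.MatchingMinorIsomorphism
import Literature.Combinatorics.SimpleGraph.PfaffianBipartite
import HarnessLib

/-!
# Pfaffian bipartite graphs, II: invariance under isomorphism of the abstract graphs

Topic `Combinatorics/SimpleGraph`; theorems only. Sequel to `PfaffianBipartite.lean` and
`MatchingMinorIsomorphism.lean` (definition item `defn-IsMatchingMinor` of route
`ValiantsHypothesis/PolyaContinued`, wanted fact (ii), easy direction: Pfaffian-ness descends
along matching minors; this file does the isomorphism steps, `MatchingMinorPfaffian.lean` the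
central-subgraph and bicontraction steps).

`MatchingMinor.IsIsomorphic G G'` is isomorphism of the underlying ABSTRACT graphs on
`Fin n ⊕ Fin n`; the bijection `φ` may exchange rows and columns on some connected components, so
the sign of a single transported perfect matching is not controlled. What is invariant is the
RELATIVE sign of two perfect matchings `σ, σ'` (`sign_isoPerm_mul_sign_isoPerm`): the
permutation "partner in `σ`, then partner in `σ'`" of the whole vertex set
(`matchEquiv σ` followed by `matchEquiv σ'`) acts on the rows as `σ'σ⁻¹` and on the columns as
`σ'⁻¹σ`, so its cycle type is twice the cycle type of `σ'⁻¹σ` (`cycleType_sumCongr`), and it is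
conjugated by `φ` under transport (`Equiv.Perm.cycleType_conj`); hence `σ'⁻¹σ` and its
transported counterpart have the same cycle type and the same sign. Since a Pólya signing is
exactly a signing under which all perfect matchings have one common sign
(`isPfaffianBipartite_of_forall_sign_eq`), pulling the signing back along `φ⁻¹` on the edges
transports Pfaffian-ness (`IsIsomorphic.isPfaffianBipartite`).

## References

* W. McCuaig, *Pólya's permanent problem*, Electron. J. Combin. 11 (2004) R79, §4 (unbalanced
  weightings are a property of the graph). [McCuaig2004]
* N. Robertson, P. D. Seymour, R. Thomas, *Permanents, Pfaffian orientations, and even directed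
  circuits*, Ann. of Math. 150 (1999) 929–975, §1. [RobertsonSeymourThomas1999]
-/

namespace Literature.Combinatorics.SimpleGraph

open Equiv Finset

/-! ### Pólya signings in the column-indexed convention -/

section Column

variable {ι : Type*} [Fintype ι] [DecidableEq ι]

/-- A Pólya signing makes every perfect matching positive, also when the matching is written
column-wise as `j ↦ (σ j, j)`. [folklore] -/
theorem IsPolyaSigning.column {G : Finset (ι × ι)} {s : ι × ι → ℤˣ} (h : IsPolyaSigning G s)
    (σ : Perm ι) (hσ : ∀ j, (σ j, j) ∈ G) : Perm.sign σ * ∏ j, s (σ j, j) = 1 := by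
  have h1 := h σ.symm fun i => by simpa using hσ (σ.symm i)
  have hp : ∏ j, s (σ j, j) = ∏ i, s (i, σ.symm i) :=
    Fintype.prod_equiv σ _ _ fun j => by simp
  rwa [Perm.sign_symm, ← hp] at h1

/-- Column-wise version of `isPfaffianBipartite_of_forall_sign_eq`: if all perfect matchings
`j ↦ (σ j, j)` have the same sign `c` under `s`, then `G` is Pfaffian. [folklore] -/
theorem isPfaffianBipartite_of_forall_column_sign_eq {G : Finset (ι × ι)} (s : ι × ι → ℤˣ)
    (c : ℤˣ) (h : ∀ σ : Perm ι, (∀ j, (σ j, j) ∈ G) → Perm.sign σ * ∏ j, s (σ j, j) = c) :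
    IsPfaffianBipartite G := by
  refine isPfaffianBipartite_of_forall_sign_eq s c fun τ hτ => ?_
  have h1 := h τ.symm fun j => by simpa using hτ (τ.symm j)
  have hp : ∏ i, s (i, τ i) = ∏ j, s (τ.symm j, j) :=
    Fintype.prod_equiv τ _ _ fun i => by simp
  rwa [Perm.sign_symm, ← hp] at h1

/-- A graph without (column-wise) perfect matchings is Pfaffian. [folklore] -/
theorem isPfaffianBipartite_of_forall_exists_not_mem' {G : Finset (ι × ι)}
    (h : ∀ σ : Perm ι, ∃ j, (σ j, j) ∉ G) : IsPfaffianBipartite G :=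
  isPfaffianBipartite_of_forall_exists_not_mem fun τ => by
    obtain ⟨j, hj⟩ := h τ.symm
    exact ⟨τ.symm j, by simpa using hj⟩

/-- In `ℤˣ` (every element is its own inverse): `a * c = b * d` gives `a * b = c * d`.
[folklore] -/
theorem units_int_mul_eq_mul_of_mul_eq_mul {a b c d : ℤˣ} (h : a * c = b * d) :
    a * b = c * d :=
  calc a * b = a * b * (c * c) * (d * d) := by
        rw [Int.units_mul_self, Int.units_mul_self, mul_one, mul_one]
    _ = (a * c) * (b * d) * (c * d) := by simp only [mul_comm, mul_left_comm]
    _ = c * d := by rw [h, ← mul_assoc, Int.units_mul_self, one_mul]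

end Column

/-! ### Cycle types -/

section CycleType

/-- The cycle type of a permutation of a sum acting separately on the summands is the sum of the
cycle types. [folklore] -/
theorem cycleType_sumCongr {α β : Type*} [Fintype α] [DecidableEq α] [Fintype β] [DecidableEq β]
    (a : Perm α) (b : Perm β) : (a.sumCongr b).cycleType = a.cycleType + b.cycleType := by
  have ha : (a.sumCongr (1 : Perm β)).cycleType = a.cycleType := by
    have key : a.sumCongr (1 : Perm β) =
        a.extendDomain (Equiv.ofInjective _ (Sum.inl_injective (β := β))) := by
      ext x
      rcases x with x | y
      · have h := Perm.extendDomain_apply_image a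
          (Equiv.ofInjective _ (Sum.inl_injective (β := β))) x
        simp only [Equiv.ofInjective_apply] at h
        rw [h]
        rfl
      · rw [Perm.extendDomain_apply_not_subtype _ _ (by simp)]
        rfl
    rw [key, Perm.cycleType_extendDomain]
  have hb : ((1 : Perm α).sumCongr b).cycleType = b.cycleType := by
    have key : (1 : Perm α).sumCongr b =
        b.extendDomain (Equiv.ofInjective _ (Sum.inr_injective (α := α))) := by
      ext x
      rcases x with x | y
      · rw [Perm.extendDomain_apply_not_subtype _ _ (by simp)]
        rfl
      · have h := Perm.extendDomain_apply_image b
          (Equiv.ofInjective _ (Sum.inr_injective (α := α))) y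
        simp only [Equiv.ofInjective_apply] at h
        rw [h]
        rfl
    rw [key, Perm.cycleType_extendDomain]
  have hd : Perm.Disjoint (a.sumCongr (1 : Perm β)) ((1 : Perm α).sumCongr b) := fun x => by
    rcases x with x | y
    · exact Or.inr rfl
    · exact Or.inl rfl
  rw [← ha, ← hb, ← hd.cycleType_mul, Perm.sumCongr_mul, mul_one, one_mul]

end CycleType

/-! ### Relative signs of perfect matchings under transport -/

section Isomorphism

variable {n : ℕ}

/-- The matching involution `matchInv σ` as a permutation of the vertex set. [folklore] -/
def matchEquiv (σ : Perm (Fin n)) : Perm (Fin n ⊕ Fin n) :=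
  ⟨matchInv σ, matchInv σ, matchInv_matchInv σ, matchInv_matchInv σ⟩

/-- `matchEquiv` is `matchInv`. [folklore] -/
@[simp] theorem matchEquiv_apply (σ : Perm (Fin n)) (v : Fin n ⊕ Fin n) :
    matchEquiv σ v = matchInv σ v := rfl

/-- "Partner in `σ`, then partner in `σ'`" acts on the rows as `σ' ∘ σ⁻¹` and on the columns as
`σ'⁻¹ ∘ σ`. [folklore] -/
theorem matchEquiv_trans_matchEquiv (σ σ' : Perm (Fin n)) :
    (matchEquiv σ).trans (matchEquiv σ') = Perm.sumCongr (σ.symm.trans σ') (σ.trans σ'.symm) := by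
  ext v
  rcases v with i | j <;> rfl

/-- `σ' ∘ σ⁻¹` and `σ'⁻¹ ∘ σ` have the same cycle type (conjugate up to inversion).
[folklore] -/
theorem cycleType_symm_trans (σ σ' : Perm (Fin n)) :
    Perm.cycleType (σ.symm.trans σ') = Perm.cycleType (σ.trans σ'.symm) := by
  have h1 : σ.symm.trans σ' = σ' * (σ⁻¹ * σ') * σ'⁻¹ := by
    rw [mul_assoc, mul_assoc, mul_inv_cancel, mul_one]; rfl
  have h2 : σ.trans σ'.symm = (σ⁻¹ * σ')⁻¹ := by
    rw [mul_inv_rev, inv_inv]; rfl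
  rw [h1, Perm.cycleType_conj, h2, Perm.cycleType_inv]

/-- The cycle type of "partner in `σ`, then partner in `σ'`" is twice that of `σ'⁻¹ ∘ σ`.
[folklore] -/
theorem cycleType_matchEquiv_trans (σ σ' : Perm (Fin n)) :
    Perm.cycleType ((matchEquiv σ).trans (matchEquiv σ')) =
      Perm.cycleType (σ.trans σ'.symm) + Perm.cycleType (σ.trans σ'.symm) := by
  rw [matchEquiv_trans_matchEquiv]
  exact (cycleType_sumCongr _ _).trans (by rw [cycleType_symm_trans])

variable {G G' : Finset (Fin n × Fin n)} {φ : Fin n ⊕ Fin n ≃ Fin n ⊕ Fin n}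

/-- The matching involution of the transported matching is the conjugate `φ ∘ matchInv σ ∘ φ⁻¹`.
[folklore] -/
theorem matchEquiv_isoPerm (hφ : ∀ a b, Adj G a b ↔ Adj G' (φ a) (φ b)) (σ : Perm (Fin n))
    (hσ : ∀ j, (σ j, j) ∈ G) :
    matchEquiv (isoPerm hφ σ hσ) = φ.symm.trans ((matchEquiv σ).trans φ) :=
  Equiv.ext fun v => matchInv_isoPerm hφ σ hσ v

/-- **Transport along an isomorphism preserves the cycle type of `σ'⁻¹σ`** for two perfect
matchings `σ, σ'` of `G`. [folklore] -/
theorem cycleType_isoPerm_trans_symm (hφ : ∀ a b, Adj G a b ↔ Adj G' (φ a) (φ b))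
    {σ σ' : Perm (Fin n)} (hσ : ∀ j, (σ j, j) ∈ G) (hσ' : ∀ j, (σ' j, j) ∈ G) :
    Perm.cycleType ((isoPerm hφ σ hσ).trans (isoPerm hφ σ' hσ').symm) =
      Perm.cycleType (σ.trans σ'.symm) := by
  have H : Perm.cycleType ((matchEquiv (isoPerm hφ σ hσ)).trans (matchEquiv (isoPerm hφ σ' hσ'))) =
      Perm.cycleType ((matchEquiv σ).trans (matchEquiv σ')) := by
    rw [matchEquiv_isoPerm, matchEquiv_isoPerm]
    have h1 : (φ.symm.trans ((matchEquiv σ).trans φ)).trans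
        (φ.symm.trans ((matchEquiv σ').trans φ)) =
        φ * ((matchEquiv σ).trans (matchEquiv σ')) * φ⁻¹ :=
      Equiv.ext fun v => by simp [Perm.mul_apply, Perm.inv_def]
    rw [h1, Perm.cycleType_conj]
  rw [cycleType_matchEquiv_trans, cycleType_matchEquiv_trans] at H
  ext m
  have hc := congrArg (Multiset.count m) H
  simp only [Multiset.count_add] at hc
  omega

/-- **The product of the signs of two perfect matchings is invariant under transport along an
isomorphism of the abstract graphs.** [folklore] -/
theorem sign_isoPerm_mul_sign_isoPerm (hφ : ∀ a b, Adj G a b ↔ Adj G' (φ a) (φ b))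
    {σ σ' : Perm (Fin n)} (hσ : ∀ j, (σ j, j) ∈ G) (hσ' : ∀ j, (σ' j, j) ∈ G) :
    Perm.sign (isoPerm hφ σ hσ) * Perm.sign (isoPerm hφ σ' hσ') =
      Perm.sign σ * Perm.sign σ' := by
  have hs : Perm.sign ((isoPerm hφ σ hσ).trans (isoPerm hφ σ' hσ').symm) =
      Perm.sign (σ.trans σ'.symm) := by
      rw [Perm.sign_of_cycleType, Perm.sign_of_cycleType, cycleType_isoPerm_trans_symm hφ hσ hσ']
  simp only [Perm.sign_trans, Perm.sign_symm] at hs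
  exact (mul_comm _ _).trans (hs.trans (mul_comm _ _))

/-- The edge maps of `φ` and `φ⁻¹` are inverse to each other on the edges of `G`. [folklore] -/
theorem isoEdgeMap_symm_isoEdgeMap (hφ : ∀ a b, Adj G a b ↔ Adj G' (φ a) (φ b))
    {e : Fin n × Fin n} (he : e ∈ G) : isoEdgeMap φ.symm (isoEdgeMap φ e) = e := by
  obtain ⟨i, j⟩ := e
  have ha : Adj G' (φ (Sum.inl i)) (φ (Sum.inr j)) := (hφ _ _).1 (by simpa using he)
  simp only [isoEdgeMap]
  rcases h1 : φ (Sum.inl i) with a | b <;> rcases h2 : φ (Sum.inr j) with a' | b'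
  · rw [h1, h2] at ha; simp at ha
  · simp [toEdge, ← h1, ← h2]
  · simp [toEdge, ← h1, ← h2]
  · rw [h1, h2] at ha; simp at ha

/-- Under the pulled-back signing `s ∘ isoEdgeMap φ⁻¹`, the transported matching has the same
sign product as the original matching under `s`. [folklore] -/
theorem prod_isoPerm_eq (hφ : ∀ a b, Adj G a b ↔ Adj G' (φ a) (φ b)) (s : Fin n × Fin n → ℤˣ)
    (σ : Perm (Fin n)) (hσ : ∀ j, (σ j, j) ∈ G) :
    ∏ j, s (isoEdgeMap φ.symm (isoPerm hφ σ hσ j, j)) = ∏ j, s (σ j, j) := by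
  rw [prod_matchingEdges (isoPerm hφ σ hσ) (fun e => s (isoEdgeMap φ.symm e)),
    ← image_isoEdgeMap_matchingEdges hφ σ hσ, Finset.prod_image, prod_matchingEdges σ]
  · refine Finset.prod_congr rfl fun e he => ?_
    obtain ⟨j, rfl⟩ := (mem_matchingEdges σ e).1 he
    rw [isoEdgeMap_symm_isoEdgeMap hφ (hσ j)]
  · exact (isoEdgeMap_injOn hφ).mono fun e he => by
      obtain ⟨j, rfl⟩ := (mem_matchingEdges σ e).1 (Finset.mem_coe.1 he)
      exact hσ j

/-- **Pfaffian-ness is invariant under isomorphism of the abstract graphs** (for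
`MatchingMinor.IsIsomorphic`, whose isomorphisms may exchange rows and columns componentwise):
pull the Pólya signing back along `φ⁻¹` on the edges; any two perfect matchings of `G'` come from
two of `G` with the same product of signs (`sign_isoPerm_mul_sign_isoPerm`), so all perfect
matchings of `G'` get one common sign, which suffices (`isPfaffianBipartite_of_forall_sign_eq`).
[folklore] -/
theorem IsIsomorphic.isPfaffianBipartite (h : IsIsomorphic G G') (hG : IsPfaffianBipartite G) :
    IsPfaffianBipartite G' := by
  classical
  obtain ⟨φ, hφ⟩ := h
  obtain ⟨s, hs⟩ := hG
  by_cases hex : ∃ ρ₀ : Perm (Fin n), ∀ j, (ρ₀ j, j) ∈ G'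
  · obtain ⟨ρ₀, hρ₀⟩ := hex
    have hφ' : ∀ a b, Adj G' a b ↔ Adj G (φ.symm a) (φ.symm b) := adj_iff_symm hφ
    have hφ'' : ∀ a b, Adj G a b ↔ Adj G' (φ.symm.symm a) (φ.symm.symm b) := adj_iff_symm hφ'
    -- every perfect matching `ρ` of `G'` is transported from the perfect matching
    -- `isoPerm hφ' ρ` of `G`; under the pulled-back signing its signed value is
    -- `sign ρ * sign (isoPerm hφ' ρ)` (the matching of `G` being positive)
    have key : ∀ (ρ : Perm (Fin n)) (hρ : ∀ j, (ρ j, j) ∈ G'),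
        Perm.sign ρ * ∏ j, s (isoEdgeMap φ.symm (ρ j, j)) =
          Perm.sign (isoPerm hφ'' (isoPerm hφ' ρ hρ) (isoPerm_mem hφ' ρ hρ)) *
            Perm.sign (isoPerm hφ' ρ hρ) := by
      intro ρ hρ
      have e1 : isoPerm hφ'' (isoPerm hφ' ρ hρ) (isoPerm_mem hφ' ρ hρ) = ρ :=
        isoPerm_symm_isoPerm hφ' ρ hρ
      have hp : ∏ j, s (isoEdgeMap φ.symm (ρ j, j)) = ∏ j, s (isoPerm hφ' ρ hρ j, j) := by
        have h3 := prod_isoPerm_eq hφ'' s (isoPerm hφ' ρ hρ) (isoPerm_mem hφ' ρ hρ)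
        rw [e1] at h3
        simpa only [Equiv.symm_symm] using h3
      have hpol := hs.column (isoPerm hφ' ρ hρ) (isoPerm_mem hφ' ρ hρ)
      rw [hp, e1, mul_right_inj]
      calc ∏ j, s (isoPerm hφ' ρ hρ j, j)
          = Perm.sign (isoPerm hφ' ρ hρ) * Perm.sign (isoPerm hφ' ρ hρ) *
              ∏ j, s (isoPerm hφ' ρ hρ j, j) := by rw [Int.units_mul_self, one_mul]
        _ = Perm.sign (isoPerm hφ' ρ hρ) := by rw [mul_assoc, hpol, mul_one]
    refine isPfaffianBipartite_of_forall_column_sign_eq (fun e' => s (isoEdgeMap φ.symm e'))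
      (Perm.sign ρ₀ * ∏ j, s (isoEdgeMap φ.symm (ρ₀ j, j))) fun ρ hρ => ?_
    show Perm.sign ρ * ∏ j, s (isoEdgeMap φ.symm (ρ j, j)) =
      Perm.sign ρ₀ * ∏ j, s (isoEdgeMap φ.symm (ρ₀ j, j))
    rw [key ρ hρ, key ρ₀ hρ₀]
    exact units_int_mul_eq_mul_of_mul_eq_mul
      (sign_isoPerm_mul_sign_isoPerm hφ'' (isoPerm_mem hφ' ρ hρ) (isoPerm_mem hφ' ρ₀ hρ₀))
  · simp only [not_exists, not_forall] at hex
    exact isPfaffianBipartite_of_forall_exists_not_mem' hex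

/-- … and conversely (isomorphism is symmetric). [folklore] -/
theorem IsIsomorphic.isPfaffianBipartite_iff (h : IsIsomorphic G G') :
    IsPfaffianBipartite G ↔ IsPfaffianBipartite G' :=
  ⟨h.isPfaffianBipartite, h.symm.isPfaffianBipartite⟩

end Isomorphism

end Literature.Combinatorics.SimpleGraph
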